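import Literature.MeasureTheory.Hausdorff.CylinderHausdorffPatch
import HarnessLib

/-!
# Round cylinders `S_V × Vᗮ`: finiteness of the Hausdorff measure on bounded pieces; patches for the product measure

Continuation of `CylinderHausdorffPatch.lean` (same setting: `dim E = n + 1`, `V ≤ E` with
`dim V = k + 1`, `Cyl = {‖P_V z‖ = 1}`):

* `cylinder_inter_ball_subset_iUnion_patch` — the `2(k+1)` patches of height `1/(2(k+1))` over
  `± b i`, `b` an orthonormal basis of `V`, cover `Cyl ∩ B(0, R)`;
* `euclideanHausdorffMeasure_cylinder_inter_ball_lt_top` (and the primed version for an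
  arbitrary centre) — **bounded pieces of the cylinder have finite `μHE[n]`-measure**, the
  finiteness input of Christensen's lemma in `CylinderHausdorffMeasure.lean`;
* `preimage_add_patch`, `map_add_prod_apply_patch` — under the addition map `V × Vᗮ → E` a patch
  pulls back to `cap v c × B(0, ρ₂)`, so the product measure `μHE[k]⌊S_V ⊗ vol_{Vᗮ}` gives it
  mass `μHE[k] (cap v c) · vol (B(0, ρ₂))`.

Support for `Literature.Geometry.Riemannian.Stone1994_cylinderEntropy`.

## References

* P. Mattila, *Geometry of sets and measures in Euclidean spaces* (1995), §4.3, Thm. 3.4.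
-/

noncomputable section

open Set Metric Module Submodule Filter
open _root_.MeasureTheory _root_.MeasureTheory.Measure
open scoped ENNReal NNReal Topology RealInnerProductSpace Pointwise

namespace Literature.MeasureTheory.Hausdorff

variable {E : Type*} [NormedAddCommGroup E] [InnerProductSpace ℝ E]

/-! ### Bounded pieces of the cylinder have finite Hausdorff measure -/

section Finite

variable {V : Submodule ℝ E} [FiniteDimensional ℝ E] [MeasurableSpace E] [BorelSpace E]

omit [MeasurableSpace E] [BorelSpace E] in
/-- **Finitely many patches cover a bounded piece of the cylinder**: every `z` with
`‖P_V z‖ = 1` and `‖z‖ < R` lies in the patch of height `1/(2(k+1))` over `b i` or over `-b i`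
for some vector of an orthonormal basis `b` of `V`, with `‖P_{Vᗮ} z‖ < R`. [folklore] -/
theorem cylinder_inter_ball_subset_iUnion_patch {k : ℕ} (b : OrthonormalBasis (Fin (k + 1)) ℝ V)
    (R : ℝ) :
    {z : E | ‖V.orthogonalProjectionOnto z‖ = 1} ∩ ball 0 R ⊆
      ⋃ i : Fin (k + 1),
        ({z : E | V.orthogonalProjectionOnto z ∈ cap (b i) (1 / (2 * (k + 1))) ∧
            ‖Vᗮ.orthogonalProjectionOnto z‖ < R} ∪
          {z : E | V.orthogonalProjectionOnto z ∈ cap (-b i) (1 / (2 * (k + 1))) ∧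
            ‖Vᗮ.orthogonalProjectionOnto z‖ < R}) := by
  rintro z ⟨hz1, hzR⟩
  simp only [mem_setOf_eq] at hz1
  rw [mem_ball_zero_iff] at hzR
  set a : V := V.orthogonalProjectionOnto z with ha_def
  have hb : ‖Vᗮ.orthogonalProjectionOnto z‖ < R := by
    have h := norm_sq_eq_add_norm_sq_projection z V
    have h1 : ‖Vᗮ.orthogonalProjectionOnto z‖ ≤ ‖z‖ := by
      nlinarith [norm_nonneg (Vᗮ.orthogonalProjectionOnto z), norm_nonneg z,
        norm_nonneg (V.orthogonalProjectionOnto z)]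
    exact h1.trans_lt hzR
  -- some coordinate of the unit vector `a` is large
  have hsum : ∑ i, ⟪b i, a⟫ ^ 2 = 1 := by rw [b.sum_sq_inner_right, hz1, one_pow]
  have hk1 : (0 : ℝ) < k + 1 := by positivity
  obtain ⟨i, hi⟩ : ∃ i, 1 / ((k : ℝ) + 1) ≤ ⟪b i, a⟫ ^ 2 := by
    by_contra h
    push Not at h
    have hlt : ∑ i : Fin (k + 1), ⟪b i, a⟫ ^ 2 < ∑ _i : Fin (k + 1), 1 / ((k : ℝ) + 1) :=
      Finset.sum_lt_sum_of_nonempty Finset.univ_nonempty fun i _ ↦ h i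
    rw [hsum, Finset.sum_const, Finset.card_univ, Fintype.card_fin, nsmul_eq_mul] at hlt
    have : ((k + 1 : ℕ) : ℝ) * (1 / ((k : ℝ) + 1)) = 1 := by push_cast; field_simp
    linarith
  have hlarge : 1 / (2 * ((k : ℝ) + 1)) < |⟪b i, a⟫| := by
    by_contra h
    push Not at h
    have h2 : ⟪b i, a⟫ ^ 2 ≤ (1 / (2 * ((k : ℝ) + 1))) ^ 2 := by
      rw [← sq_abs]; exact pow_le_pow_left₀ (abs_nonneg _) h 2
    have h3 : (1 / (2 * ((k : ℝ) + 1))) ^ 2 < 1 / ((k : ℝ) + 1) := by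
      rw [div_pow, one_pow, div_lt_div_iff₀ (by positivity) hk1]
      nlinarith
    linarith
  refine mem_iUnion.2 ⟨i, ?_⟩
  rcases lt_or_ge 0 ⟪b i, a⟫ with hpos | hneg
  · left
    refine ⟨⟨hz1, ?_⟩, hb⟩
    rw [abs_of_pos hpos] at hlarge
    exact_mod_cast hlarge
  · right
    refine ⟨⟨hz1, ?_⟩, hb⟩
    rw [abs_of_nonpos hneg] at hlarge
    rw [inner_neg_left]
    exact_mod_cast hlarge

/-- **Bounded pieces of the round cylinder have finite `μHE[n]`-measure**: for `dim E = n + 1`,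
`dim V = k + 1`, `μHE[n] ({‖P_V z‖ = 1} ∩ B(0, R)) < ∞`. [folklore] -/
theorem euclideanHausdorffMeasure_cylinder_inter_ball_lt_top {n k : ℕ} (hE : finrank ℝ E = n + 1)
    (hV : finrank ℝ V = k + 1) (R : ℝ) :
    (μHE[n] : Measure E) ({z : E | ‖V.orthogonalProjectionOnto z‖ = 1} ∩ ball 0 R) < ⊤ := by
  set b : OrthonormalBasis (Fin (k + 1)) ℝ V := (stdOrthonormalBasis ℝ V).reindex (finCongr hV)
  have hc0 : (0 : ℝ) < 1 / (2 * (k + 1)) := by positivity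
  have hc1 : (1 : ℝ) / (2 * (k + 1)) < 1 := by
    rw [div_lt_one (by positivity)]
    have := Nat.cast_nonneg (α := ℝ) k
    linarith
  refine (measure_mono (cylinder_inter_ball_subset_iUnion_patch b R)).trans_lt ?_
  refine (measure_iUnion_fintype_le _ _).trans_lt ?_
  refine ENNReal.sum_lt_top.2 fun i _ ↦ ?_
  refine (measure_union_le _ _).trans_lt (ENNReal.add_lt_top.2 ⟨?_, ?_⟩)
  · exact euclideanHausdorffMeasure_patch_lt_top hE hV (b.orthonormal.1 i) hc0 hc1 R
  · have : ‖-b i‖ = 1 := by rw [norm_neg]; exact b.orthonormal.1 i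
    exact euclideanHausdorffMeasure_patch_lt_top hE hV this hc0 hc1 R

/-- The same for balls with arbitrary centre. [folklore] -/
theorem euclideanHausdorffMeasure_cylinder_inter_ball_lt_top' {n k : ℕ} (hE : finrank ℝ E = n + 1)
    (hV : finrank ℝ V = k + 1) (x : E) (R : ℝ) :
    (μHE[n] : Measure E) ({z : E | ‖V.orthogonalProjectionOnto z‖ = 1} ∩ ball x R) < ⊤ := by
  refine (measure_mono ?_).trans_lt (euclideanHausdorffMeasure_cylinder_inter_ball_lt_top hE hV (‖x‖ + R))
  rintro z ⟨hz, hzx⟩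
  refine ⟨hz, ?_⟩
  rw [mem_ball_zero_iff]
  rw [mem_ball] at hzx
  rw [dist_eq_norm] at hzx
  calc ‖z‖ = ‖(z - x) + x‖ := by rw [sub_add_cancel]
    _ ≤ ‖z - x‖ + ‖x‖ := norm_add_le _ _
    _ < ‖x‖ + R := by linarith

end Finite

/-! ### The product measure of a patch -/

section Product

variable {V : Submodule ℝ E} {v : V} [FiniteDimensional ℝ E] [MeasurableSpace E] [BorelSpace E]

omit [MeasurableSpace E] [BorelSpace E] in
/-- The preimage of a patch under the addition map `V × Vᗮ → E` is the product
`cap v c × B(0, ρ₂)`. [folklore] -/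
theorem preimage_add_patch (c ρ₂ : ℝ) :
    (fun p : V × Vᗮ ↦ (p.1 : E) + (p.2 : E)) ⁻¹'
        {z : E | V.orthogonalProjectionOnto z ∈ cap v c ∧ ‖Vᗮ.orthogonalProjectionOnto z‖ < ρ₂} =
      cap v c ×ˢ ball (0 : Vᗮ) ρ₂ := by
  ext p
  simp only [mem_preimage, mem_setOf_eq, Set.mem_prod, map_add, mem_ball_zero_iff,
    orthogonalProjectionOnto_mem_subspace_eq_self,
    orthogonalProjectionOnto_apply_of_mem_orthogonal p.2.2,
    orthogonalProjectionOnto_orthogonal_apply_eq_zero p.1.2, add_zero, zero_add]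

/-- **The product measure of a patch**: for the measure
`ν = (μHE[k]⌊S_V ⊗ vol_{Vᗮ}) ∘ (a, b ↦ a + b)⁻¹`,
`ν {z | P_V z ∈ cap v c, ‖P_{Vᗮ} z‖ < ρ₂} = μHE[k] (cap v c) · vol (B(0, ρ₂))`. [folklore] -/
theorem map_add_prod_apply_patch (k : ℕ) (c ρ₂ : ℝ) :
    Measure.map (fun p : V × Vᗮ ↦ (p.1 : E) + (p.2 : E))
        (((μHE[k] : Measure V).restrict (sphere 0 1)).prod (volume : Measure Vᗮ))
        {z : E | V.orthogonalProjectionOnto z ∈ cap v c ∧ ‖Vᗮ.orthogonalProjectionOnto z‖ < ρ₂} =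
      (μHE[k] : Measure V) (cap v c) * (volume : Measure Vᗮ) (ball 0 ρ₂) := by
  have hmeas : MeasurableSet {z : E | V.orthogonalProjectionOnto z ∈ cap v c ∧
      ‖Vᗮ.orthogonalProjectionOnto z‖ < ρ₂} := by
    have hcap : MeasurableSet (cap v c) := by
      have : cap v c = sphere (0 : V) 1 ∩ {x : V | c < ⟪v, x⟫} := by
        ext x; simp [cap]
      rw [this]
      exact isClosed_sphere.measurableSet.inter
        (isOpen_lt continuous_const (continuous_const.inner continuous_id)).measurableSet
    have h1 : MeasurableSet (V.orthogonalProjectionOnto ⁻¹' cap v c) :=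
      V.orthogonalProjectionOnto.continuous.measurable hcap
    have h2 : MeasurableSet {z : E | ‖Vᗮ.orthogonalProjectionOnto z‖ < ρ₂} :=
      measurableSet_lt (Vᗮ.orthogonalProjectionOnto.continuous.norm).measurable measurable_const
    exact h1.inter h2
  rw [Measure.map_apply (by fun_prop) hmeas, preimage_add_patch, Measure.prod_prod,
    Measure.restrict_apply' isClosed_sphere.measurableSet,
    inter_eq_left.2 (cap_subset_sphere v c)]

end Product

end Literature.MeasureTheory.Hausdorff

end
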